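import Summits.NavierStokesRegularity.FluidComputer.DihedralSector
import HarnessLib

/-!
# The dihedral sector is sharp: exactly the mirror lines are forced, and the vertical axis is empty

HONEST FRAMING (cell `pub-fluidc`, verbatim): *low prior, high value-of-information experiment on Tao's
machine paradigm; NOT a claim that NS blows up.* Nothing here concerns the Navier–Stokes PDE beyond the
Galerkin-truncated ODE system both engines of the cell integrate.

Companion of `DihedralSector` (pub-fluidc-lit gen 21, p214574), `DihedralSectorWitness` (p214776) and
`SublatticeSupport` (p213261), written by the GADGETS lane (gen 47): it closes the symmetry analysis of the
pure-swirl Hou–Luo-type gadget data (GADGETS gens 43/46, `code/gadgets/tests/houluo_floor_j092806.md` §1) in the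
`z`-MEAN PLANE as an `iff` over ALL shells, and adds the VERTICAL AXIS (a forced-empty set not recorded before):

* `coeff_eq_zero_of_vertical_axis`, `vertical_axis_empty` — the quarter turn `R90` ALONE (with
  incompressibility) empties every wavevector `(0, 0, k₂)`, `k₂ ≠ 0`, at every time along an unforced Galerkin
  solution on a quarter-turn-invariant mask whose datum is fixed by `rotZ.act` (all shells, any vertical period,
  any `eps_pol`): `û₀ = -û₁`, `û₁ = û₀` force the horizontal part to vanish and `k₂ û₂ = 0` the vertical one;
  with `S_a` as well the zero mode joins (`coeff_eq_zero_of_horizontal_mean`, `horizontal_mean_empty`): the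
  horizontally averaged velocity `ū(z, t)` is identically zero — an exact diagnostic at every vertical wavenumber.
* `witness N` — for every integer `N` an explicit real, incompressible, finitely supported coefficient field
  (stream function `ψ̂(k) = k₀ k₁ (k₀² − k₁²)` on the circle `k₂ = 0`, `k₀² + k₁² = N`, the `D₄` pseudoscalar
  `A₂`; for `N = 5` it is `ψ ∝ sin x sin y (cos x − cos y)` up to normalisation) fixed by EVERY vertical
  translation, by `reflX.sg (vertical a)`, `reflZ.sg (vertical a)`, `rotZ.sg (vertical a)` for every `a` and by
  `rotZ.act`, whose coefficient at a `z`-mean wavevector `k` with `k₀² + k₁² = N` is non-zero EXACTLY when `k` is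
  off the four mirror lines (`witness_coeff_ne_zero`).
* `forced_empty_iff` — hence, for a `z`-mean wavevector `k`, "every field fixed by all vertical translations,
  all `G_a = T_a ∘ (x ↦ -x)`, all `S_a = T_a ∘ (z ↦ -z)` and the quarter turn has `û(k) = 0`" holds IF AND ONLY
  IF `k₀ k₁ (k₀² − k₁²) = 0`: the mirror-line theorem `DihedralSector.coeff_eq_zero_of_mirror_line` cannot be
  extended to a single further `z`-mean mode, on ANY shell, by symmetry considerations. (The shell `|k|² = 5`
  alone — the eight modes `(±2, ±1, 0)`, `(±1, ±2, 0)` — is `DihedralSectorWitness.lean`, pub-fluidc-lit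
  p214776, whose `DihedralSector.wit` has the same coefficients as `witness 5`; the present file is the
  every-shell statement and is independent of it.)

Reading for the engines (information, not a claim about any run): in an exactly symmetric integration the modes
`{k₂ = 0, k₀ k₁ (k₀² − k₁²) = 0} ∪ {(0, 0, k₂) : k₂ ∈ ℤ} ∪ {k : m ∤ k₂}` are ZERO at every step up to round-off
and are usable as symmetry diagnostics; non-zero content in the `A₂` sector (first at `|k|² = 5`) is NOT a
symmetry defect. What is NOT claimed: which off-plane modes with `m ∣ k₂ ≠ 0` off the vertical axis are forced
(none is typed here either way); anything about round-off; anything dynamical beyond persistence of symmetry.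
0 sorry, 0 named facts (D-0026). [folklore]
-/

noncomputable section

namespace Summit.NavierStokesRegularity.FluidComputer.DihedralSectorSharp

open Literature.Analysis.FluidPDE.FluidComputer
open Literature.Analysis.FluidPDE.FluidComputer.ShellTransfer
open Complex

/-! ## The vertical axis: emptied by the quarter turn alone -/

/-- **A field fixed by the quarter turn vanishes on the vertical axis** `k = (0, 0, k₂)`, `k₂ ≠ 0`: the quarter
turn fixes `k` and rotates `(û₀, û₁)` by a right angle, so `û₀ = û₁ = 0`; incompressibility `k₂ û₂ = 0` gives
`û₂ = 0`. (The zero mode needs `S` as well: `DihedralSector.coeff_zero_eq_zero`.) [folklore] -/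
theorem coeff_eq_zero_of_vertical_axis {A : FourierVelocity} (hR : rotZ.act A = A) {k : Fin 3 → ℤ}
    (hk0 : k 0 = 0) (hk1 : k 1 = 0) (hk2 : k 2 ≠ 0) : A.coeff k = 0 := by
  have e : (![k 1, -k 0, k 2] : Fin 3 → ℤ) = k := by
    funext i; fin_cases i <;> simp [hk0, hk1]
  have h0 := DihedralSector.coeff_eq_of_R hR k 0
  have h1 := DihedralSector.coeff_eq_of_R hR k 1
  rw [e] at h0 h1
  unfold rotZ at h0 h1
  simp [Fin.sum_univ_three] at h0 h1
  -- h0 : A.coeff k 0 = -A.coeff k 1 ; h1 : A.coeff k 1 = A.coeff k 0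
  have hu0 : A.coeff k 0 = 0 := by linear_combination (h0 - h1) / 2
  have hu1 : A.coeff k 1 = 0 := by linear_combination (h0 + h1) / 2
  have hd := A.divFree k
  rw [Fin.sum_univ_three, hu0, hu1] at hd
  have hk2C : ((k 2 : ℤ) : ℂ) ≠ 0 := by exact_mod_cast hk2
  have hu2 : A.coeff k 2 = 0 := by
    have : ((k 2 : ℤ) : ℂ) * A.coeff k 2 = 0 := by simpa using hd
    exact (mul_eq_zero.mp this).resolve_left hk2C
  funext j
  fin_cases j
  · exact hu0
  · exact hu1
  · exact hu2

/-- **THE VERTICAL AXIS STAYS EMPTY.** Along every unforced Galerkin solution (any `ν`, any pressure multiplier)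
supported in a mask mapped into itself by the quarter turn, whose datum at one time is fixed by the quarter turn,
every wavevector `(0, 0, k₂)`, `k₂ ≠ 0`, carries zero coefficient and zero energy at every time. [folklore] -/
theorem vertical_axis_empty {U : ℝ → FourierVelocity} {S : Finset (Fin 3 → ℤ)} {ν : ℝ}
    {c : ℝ → (Fin 3 → ℤ) → ℂ} (hU : IsGalerkinSolution U S ν c fun _ _ _ => 0) (hs : IsSupportedOn U S)
    (hRi : ∀ p ∈ S, rotZ.invK p ∈ S) (hRa : ∀ p ∈ S, rotZ.actK p ∈ S) {t₀ : ℝ} (hR : rotZ.act (U t₀) = U t₀)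
    (t : ℝ) {k : Fin 3 → ℤ} (hk0 : k 0 = 0) (hk1 : k 1 = 0) (hk2 : k 2 ≠ 0) :
    (U t).coeff k = 0 ∧ modalEnergy (U t) k = 0 := by
  have hRt := rotZ.act_eq_self hU hs hRi hRa hR t
  have h := coeff_eq_zero_of_vertical_axis hRt hk0 hk1 hk2
  exact ⟨h, modalEnergy_eq_zero_of_coeff _ h⟩

/-- **The whole line `k₀ = k₁ = 0`** (the horizontally averaged flow `ū(z)`): with `S_a` as well, the zero
mode is included. [folklore] -/
theorem coeff_eq_zero_of_horizontal_mean {A : FourierVelocity} {a : ℝ} (hS : reflZ.sg (vertical a) A = A)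
    (hR : rotZ.act A = A) {k : Fin 3 → ℤ} (hk0 : k 0 = 0) (hk1 : k 1 = 0) : A.coeff k = 0 := by
  by_cases hk2 : k 2 = 0
  · have : k = 0 := by funext i; fin_cases i <;> simp [hk0, hk1, hk2]
    rw [this]
    exact DihedralSector.coeff_zero_eq_zero hS hR
  · exact coeff_eq_zero_of_vertical_axis hR hk0 hk1 hk2

/-- **NO HORIZONTALLY AVERAGED FLOW, EVER.** Along every unforced Galerkin solution on a mask mapped into itself
by `z ↦ -z` and the quarter turn, whose datum is fixed by `S_a = T_a ∘ (z ↦ -z)` and the quarter turn, every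
wavevector `(0, 0, k₂)` (all `k₂ ∈ ℤ`) is empty at every time: the horizontal mean `ū(z, t)` vanishes
identically. [folklore] -/
theorem horizontal_mean_empty {U : ℝ → FourierVelocity} {S : Finset (Fin 3 → ℤ)} {ν : ℝ}
    {c : ℝ → (Fin 3 → ℤ) → ℂ} (hU : IsGalerkinSolution U S ν c fun _ _ _ => 0) (hs : IsSupportedOn U S)
    (hZ : ∀ p ∈ S, reflZ.invK p ∈ S) (hZ' : ∀ p ∈ S, reflZ.actK p ∈ S)
    (hRi : ∀ p ∈ S, rotZ.invK p ∈ S) (hRa : ∀ p ∈ S, rotZ.actK p ∈ S) {a : ℝ} {t₀ : ℝ}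
    (hSz : reflZ.sg (vertical a) (U t₀) = U t₀) (hR : rotZ.act (U t₀) = U t₀) (t : ℝ) {k : Fin 3 → ℤ}
    (hk0 : k 0 = 0) (hk1 : k 1 = 0) : (U t).coeff k = 0 ∧ modalEnergy (U t) k = 0 := by
  have hSt := reflZ.sg_eq_self hU hs hZ hZ' (vertical a) hSz t
  have hRt := rotZ.act_eq_self hU hs hRi hRa hR t
  have h := coeff_eq_zero_of_horizontal_mean hSt hRt hk0 hk1
  exact ⟨h, modalEnergy_eq_zero_of_coeff _ h⟩

/-! ## The witness family: the `A₂` pseudoscalar on a `z`-mean circle -/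

/-- Stream-function coefficients of the witness: `ψ̂_N(k) = k₀ k₁ (k₀² − k₁²)` on the circle `k₂ = 0`,
`k₀² + k₁² = N`, and `0` elsewhere (integer valued, even in `k`). [folklore] -/
def psiHat (N : ℤ) (k : Fin 3 → ℤ) : ℤ :=
  if k 2 = 0 ∧ k 0 ^ 2 + k 1 ^ 2 = N then k 0 * k 1 * (k 0 ^ 2 - k 1 ^ 2) else 0

/-- On its circle the witness stream function is the pseudoscalar polynomial. [folklore] -/
theorem psiHat_of_mem {N : ℤ} {k : Fin 3 → ℤ} (h : k 2 = 0 ∧ k 0 ^ 2 + k 1 ^ 2 = N) :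
    psiHat N k = k 0 * k 1 * (k 0 ^ 2 - k 1 ^ 2) := by
  unfold psiHat; rw [if_pos h]

/-- Off its circle the witness stream function vanishes. [folklore] -/
theorem psiHat_of_not_mem {N : ℤ} {k : Fin 3 → ℤ} (h : ¬ (k 2 = 0 ∧ k 0 ^ 2 + k 1 ^ 2 = N)) :
    psiHat N k = 0 := by
  unfold psiHat; rw [if_neg h]

/-- Off the `z`-mean plane the witness has no stream function. [folklore] -/
theorem psiHat_of_ne {N : ℤ} {k : Fin 3 → ℤ} (h : k 2 ≠ 0) : psiHat N k = 0 :=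
  psiHat_of_not_mem fun hk => h hk.1

/-- `ψ̂(-k) = ψ̂(k)` (reality of `ψ`). [folklore] -/
theorem psiHat_neg (N : ℤ) (k : Fin 3 → ℤ) : psiHat N (-k) = psiHat N k := by
  by_cases h : k 2 = 0 ∧ k 0 ^ 2 + k 1 ^ 2 = N
  · have h' : (-k) 2 = 0 ∧ (-k) 0 ^ 2 + (-k) 1 ^ 2 = N := by
      refine ⟨by simp [h.1], ?_⟩
      simp only [Pi.neg_apply, neg_sq]; exact h.2
    rw [psiHat_of_mem h, psiHat_of_mem h']
    simp only [Pi.neg_apply]; ring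
  · have h' : ¬ ((-k) 2 = 0 ∧ (-k) 0 ^ 2 + (-k) 1 ^ 2 = N) := by
      rintro ⟨h2, hN⟩
      refine h ⟨by simpa using h2, ?_⟩
      simpa only [Pi.neg_apply, neg_sq] using hN
    rw [psiHat_of_not_mem h, psiHat_of_not_mem h']

/-- `ψ̂(-k₀, k₁, k₂) = -ψ̂(k)` (`ψ` is odd under `x ↦ -x`). [folklore] -/
theorem psiHat_reflX (N : ℤ) (k : Fin 3 → ℤ) : psiHat N ![-k 0, k 1, k 2] = -psiHat N k := by
  by_cases h : k 2 = 0 ∧ k 0 ^ 2 + k 1 ^ 2 = N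
  · have h' : (![-k 0, k 1, k 2] : Fin 3 → ℤ) 2 = 0 ∧
        (![-k 0, k 1, k 2] : Fin 3 → ℤ) 0 ^ 2 + (![-k 0, k 1, k 2] : Fin 3 → ℤ) 1 ^ 2 = N := by
      refine ⟨by simp [h.1], ?_⟩
      simp only [Matrix.cons_val_zero, Matrix.cons_val_one, neg_sq]; exact h.2
    rw [psiHat_of_mem h, psiHat_of_mem h']
    simp
  · have h' : ¬ ((![-k 0, k 1, k 2] : Fin 3 → ℤ) 2 = 0 ∧
        (![-k 0, k 1, k 2] : Fin 3 → ℤ) 0 ^ 2 + (![-k 0, k 1, k 2] : Fin 3 → ℤ) 1 ^ 2 = N) := by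
      rintro ⟨h2, hN⟩
      refine h ⟨by simpa using h2, ?_⟩
      simpa only [Matrix.cons_val_zero, Matrix.cons_val_one, Matrix.head_cons, neg_sq] using hN
    rw [psiHat_of_not_mem h, psiHat_of_not_mem h', neg_zero]

/-- `ψ̂(k₁, -k₀, k₂) = ψ̂(k)` (`ψ` is fixed by the quarter turn). [folklore] -/
theorem psiHat_rotZ (N : ℤ) (k : Fin 3 → ℤ) : psiHat N ![k 1, -k 0, k 2] = psiHat N k := by
  by_cases h : k 2 = 0 ∧ k 0 ^ 2 + k 1 ^ 2 = N
  · have h' : (![k 1, -k 0, k 2] : Fin 3 → ℤ) 2 = 0 ∧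
        (![k 1, -k 0, k 2] : Fin 3 → ℤ) 0 ^ 2 + (![k 1, -k 0, k 2] : Fin 3 → ℤ) 1 ^ 2 = N := by
      refine ⟨by simp [h.1], ?_⟩
      simp only [Matrix.cons_val_zero, Matrix.cons_val_one, neg_sq]; linarith [h.2]
    rw [psiHat_of_mem h, psiHat_of_mem h']
    simp; ring
  · have h' : ¬ ((![k 1, -k 0, k 2] : Fin 3 → ℤ) 2 = 0 ∧
        (![k 1, -k 0, k 2] : Fin 3 → ℤ) 0 ^ 2 + (![k 1, -k 0, k 2] : Fin 3 → ℤ) 1 ^ 2 = N) := by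
      rintro ⟨h2, hN⟩
      refine h ⟨by simpa using h2, ?_⟩
      simp only [Matrix.cons_val_zero, Matrix.cons_val_one, neg_sq] at hN; linarith
    rw [psiHat_of_not_mem h, psiHat_of_not_mem h']

/-- `ψ̂(k₀, k₁, -k₂) = ψ̂(k)` (`ψ` does not depend on `z`). [folklore] -/
theorem psiHat_reflZ (N : ℤ) (k : Fin 3 → ℤ) : psiHat N ![k 0, k 1, -k 2] = psiHat N k := by
  by_cases h : k 2 = 0 ∧ k 0 ^ 2 + k 1 ^ 2 = N
  · have h' : (![k 0, k 1, -k 2] : Fin 3 → ℤ) 2 = 0 ∧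
        (![k 0, k 1, -k 2] : Fin 3 → ℤ) 0 ^ 2 + (![k 0, k 1, -k 2] : Fin 3 → ℤ) 1 ^ 2 = N := by
      exact ⟨by simp [h.1], by simpa using h.2⟩
    rw [psiHat_of_mem h, psiHat_of_mem h']
    simp
  · have h' : ¬ ((![k 0, k 1, -k 2] : Fin 3 → ℤ) 2 = 0 ∧
        (![k 0, k 1, -k 2] : Fin 3 → ℤ) 0 ^ 2 + (![k 0, k 1, -k 2] : Fin 3 → ℤ) 1 ^ 2 = N) := by
      rintro ⟨h2, hN⟩
      exact h ⟨by simpa using h2, by simpa using hN⟩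
    rw [psiHat_of_not_mem h, psiHat_of_not_mem h']

/-- **The witness** `û_N(k) = (i k₁ ψ̂_N(k), -i k₀ ψ̂_N(k), 0)`: the horizontal incompressible field with stream
function `ψ_N`, as a real incompressible Fourier coefficient field. [folklore] -/
def witness (N : ℤ) : FourierVelocity where
  coeff k := ![I * ((k 1 : ℤ) : ℂ) * ((psiHat N k : ℤ) : ℂ), -(I * ((k 0 : ℤ) : ℂ) * ((psiHat N k : ℤ) : ℂ)), 0]
  reality k i := by
    fin_cases i
    · simp [psiHat_neg]
    · simp [psiHat_neg]
    · simp
  divFree k := by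
    simp [Fin.sum_univ_three]; ring

/-- `û₀ = i k₁ ψ̂`. [folklore] -/
@[simp] theorem witness_coeff_zero (N : ℤ) (k : Fin 3 → ℤ) :
    (witness N).coeff k 0 = I * ((k 1 : ℤ) : ℂ) * ((psiHat N k : ℤ) : ℂ) := rfl

/-- `û₁ = -i k₀ ψ̂`. [folklore] -/
@[simp] theorem witness_coeff_one (N : ℤ) (k : Fin 3 → ℤ) :
    (witness N).coeff k 1 = -(I * ((k 0 : ℤ) : ℂ) * ((psiHat N k : ℤ) : ℂ)) := rfl

/-- `û₂ = 0` (a horizontal field). [folklore] -/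
@[simp] theorem witness_coeff_two (N : ℤ) (k : Fin 3 → ℤ) : (witness N).coeff k 2 = 0 := rfl

/-- The witness is finitely supported: on the circle `k₂ = 0`, `k₀² + k₁² = N` only. [folklore] -/
theorem witness_coeff_eq_zero {N : ℤ} {k : Fin 3 → ℤ} (h : ¬ (k 2 = 0 ∧ k 0 ^ 2 + k 1 ^ 2 = N)) :
    (witness N).coeff k = 0 := by
  funext j
  fin_cases j <;> simp [psiHat_of_not_mem h]

/-- The witness is fixed by `z ↦ -z`. [folklore] -/
theorem reflZ_act_witness (N : ℤ) : reflZ.act (witness N) = witness N := by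
  apply TaylorGreenHat.fourierVelocity_ext
  funext k j
  rw [LatticeIsometry.act_coeff, reflZ_invK]
  unfold reflZ
  fin_cases j <;> simp [Fin.sum_univ_three, psiHat_reflZ]

/-- The witness is fixed by `x ↦ -x`. [folklore] -/
theorem reflX_act_witness (N : ℤ) : reflX.act (witness N) = witness N := by
  apply TaylorGreenHat.fourierVelocity_ext
  funext k j
  rw [LatticeIsometry.act_coeff, reflX_invK]
  unfold reflX
  fin_cases j <;> simp [Fin.sum_univ_three, psiHat_reflX]

/-- The witness is fixed by the quarter turn. [folklore] -/
theorem rotZ_act_witness (N : ℤ) : rotZ.act (witness N) = witness N := by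
  apply TaylorGreenHat.fourierVelocity_ext
  funext k j
  rw [LatticeIsometry.act_coeff, rotZ_invK]
  unfold rotZ
  fin_cases j <;> simp [Fin.sum_univ_three, psiHat_rotZ]

/-- The witness is fixed by every vertical translation (it is a `z`-mean field). [folklore] -/
theorem translate_vertical_witness (N : ℤ) (d : ℝ) : translate (vertical d) (witness N) = witness N := by
  apply TaylorGreenHat.fourierVelocity_ext
  funext k j
  rw [translate_coeff]
  by_cases hk2 : k 2 = 0
  · rw [DihedralSector.phase_vertical_of_zmean d hk2, one_mul]
  · fin_cases j <;> simp [psiHat_of_ne hk2]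

/-- Hence it is fixed by `S_a = T_a ∘ (z ↦ -z)` for every vertical shift `a`. [folklore] -/
theorem reflZ_sg_witness (N : ℤ) (a : ℝ) : reflZ.sg (vertical a) (witness N) = witness N := by
  rw [LatticeIsometry.sg_def, reflZ_act_witness, translate_vertical_witness]

/-- … by `G_a = T_a ∘ (x ↦ -x)` for every vertical shift `a`. [folklore] -/
theorem reflX_sg_witness (N : ℤ) (a : ℝ) : reflX.sg (vertical a) (witness N) = witness N := by
  rw [LatticeIsometry.sg_def, reflX_act_witness, translate_vertical_witness]

/-- … and by the quarter turn followed by any vertical shift. [folklore] -/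
theorem rotZ_sg_witness (N : ℤ) (a : ℝ) : rotZ.sg (vertical a) (witness N) = witness N := by
  rw [LatticeIsometry.sg_def, rotZ_act_witness, translate_vertical_witness]

/-- **Off the mirror lines the witness does not vanish.** [folklore] -/
theorem witness_coeff_ne_zero {k : Fin 3 → ℤ} (hk2 : k 2 = 0) (hoff : k 0 * k 1 * (k 0 ^ 2 - k 1 ^ 2) ≠ 0) :
    (witness (k 0 ^ 2 + k 1 ^ 2)).coeff k ≠ 0 := by
  have hψ : psiHat (k 0 ^ 2 + k 1 ^ 2) k = k 0 * k 1 * (k 0 ^ 2 - k 1 ^ 2) := psiHat_of_mem ⟨hk2, rfl⟩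
  have hk1 : k 1 ≠ 0 := by
    intro h1; apply hoff; rw [h1]; ring
  intro h
  have h0 : (witness (k 0 ^ 2 + k 1 ^ 2)).coeff k 0 = 0 := by rw [h]; rfl
  rw [witness_coeff_zero, hψ] at h0
  have hk1C : ((k 1 : ℤ) : ℂ) ≠ 0 := by exact_mod_cast hk1
  have hoffC : (((k 0 * k 1 * (k 0 ^ 2 - k 1 ^ 2) : ℤ)) : ℂ) ≠ 0 := by exact_mod_cast hoff
  exact mul_ne_zero (mul_ne_zero I_ne_zero hk1C) hoffC h0

/-! ## Sharpness and the `iff` -/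

/-- The mirror-line predicate in product form. [folklore] -/
theorem mirrorLine_iff (k : Fin 3 → ℤ) :
    k 0 * k 1 * (k 0 ^ 2 - k 1 ^ 2) = 0 ↔ (k 0 = 0 ∨ k 1 = 0 ∨ k 0 = k 1 ∨ k 0 = -k 1) := by
  constructor
  · intro h
    rcases mul_eq_zero.mp h with h | h
    · rcases mul_eq_zero.mp h with h | h
      · exact Or.inl h
      · exact Or.inr (Or.inl h)
    · have : k 0 ^ 2 = k 1 ^ 2 := by linear_combination h
      rcases sq_eq_sq_iff_eq_or_eq_neg.mp this with h | h
      · exact Or.inr (Or.inr (Or.inl h))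
      · exact Or.inr (Or.inr (Or.inr h))
  · rintro (h | h | h | h)
    · rw [h]; ring
    · rw [h]; ring
    · rw [h]; ring
    · rw [h]; ring

/-- **FREE OFF THE MIRROR LINES.** For every `z`-mean wavevector off the four mirror lines there is a real,
incompressible, finitely supported coefficient field fixed by every vertical translation, by `G_a`, `S_a` and
`R90` (with or without a vertical shift) for every `a`, whose coefficient at `k` is non-zero. [folklore] -/
theorem free_of_off_mirror_line {k : Fin 3 → ℤ} (hk2 : k 2 = 0)
    (hoff : k 0 * k 1 * (k 0 ^ 2 - k 1 ^ 2) ≠ 0) :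
    ∃ W : FourierVelocity, (∀ d : ℝ, translate (vertical d) W = W) ∧
      (∀ a : ℝ, reflX.sg (vertical a) W = W) ∧ (∀ a : ℝ, reflZ.sg (vertical a) W = W) ∧
      (∀ a : ℝ, rotZ.sg (vertical a) W = W) ∧ rotZ.act W = W ∧ W.coeff k ≠ 0 :=
  ⟨witness (k 0 ^ 2 + k 1 ^ 2), translate_vertical_witness _, reflX_sg_witness _, reflZ_sg_witness _,
    rotZ_sg_witness _, rotZ_act_witness _, witness_coeff_ne_zero hk2 hoff⟩

/-- **THE DIHEDRAL SECTOR IS EXACTLY THE MIRROR LINES.** For a `z`-mean wavevector `k`: every real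
incompressible coefficient field fixed by all vertical translations, all `G_a`, all `S_a` and the quarter turn
vanishes at `k` — if and only if `k` lies on one of the four mirror lines `k₀ k₁ (k₀² − k₁²) = 0`. (`⇐` is
`DihedralSector.coeff_eq_zero_of_mirror_line`, which needs only one `a`; `⇒` is the witness.) [folklore] -/
theorem forced_empty_iff {k : Fin 3 → ℤ} (hk2 : k 2 = 0) :
    (∀ W : FourierVelocity, (∀ d : ℝ, translate (vertical d) W = W) →
        (∀ a : ℝ, reflX.sg (vertical a) W = W) → (∀ a : ℝ, reflZ.sg (vertical a) W = W) →
        rotZ.act W = W → W.coeff k = 0) ↔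
      k 0 * k 1 * (k 0 ^ 2 - k 1 ^ 2) = 0 := by
  constructor
  · intro h
    by_contra hoff
    obtain ⟨W, hT, hX, hZ, -, hR, hW⟩ := free_of_off_mirror_line hk2 hoff
    exact hW (h W hT hX hZ hR)
  · intro hline W _ hX hZ hR
    exact DihedralSector.coeff_eq_zero_of_mirror_line (hX 0) (hZ 0) hR hk2 ((mirrorLine_iff k).mp hline)

end Summit.NavierStokesRegularity.FluidComputer.DihedralSectorSharp

end
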